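import Summits.BirchSwinnertonDyer.BirchSwinnertonDyer.Theorems.GenusKolyvaginAtTwoKolyvaginRelationAtTwoLemma43
import Summits.BirchSwinnertonDyer.BirchSwinnertonDyer.Theorems.ByReductionTypeAtTwoRankOneAtTwoBigImageOddLocalOneDoorIndexLawOfKolyvaginExact
import Summits.BirchSwinnertonDyer.Rank1Residual.F1Sign2.KolyvaginSystemGenusTwistAtTwo
import HarnessLib

/-!
# Route ByReductionTypeAtTwo, crux `RankOneAtTwoBigImageOddLocal` (stmt-BirchSwinnertonDyer-23715), line `one_door_analytic`:
# NO `2`-TORSION ANYWHERE IN THE RING CLASS TOWER of a door field — the tower binder of -es's first-layer laws DISCHARGED on the slice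

Lead prover seat `bsd-line-fkl-p1` g19 (2026-08-29).  THEOREMS ONLY (standard axioms; no `def`, no named fact, no `sorry`, nothing
conditional).  Helper file `--supports stmt-BirchSwinnertonDyer-23715`; it does not close the crux and BSD is not proved by any of this.

-es's typed laws on the first Kolyvagin layer at `2` — ES-24k± `FirstLayerSignedStructureLawAtTwo`, ES-24g `FirstLayerVanishesAtGenusDoors`
(`F1Sign2/HalvedGenusPointFirstLayerAtTwo.lean`) and THE §25 CANDIDATE ES-25g `KolyvaginSystemVanishesModTwoAtGenusDoors`
(`F1Sign2/KolyvaginSystemGenusTwistAtTwo.lean`) — carry the binder «no `2`-torsion in the ring class tower»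
`∀ (n : ℕ) (Q : (W.baseChange (ringClassField K ι n)).toAffine.Point), 2 • Q = 0 → Q = 0`.  REF1 §152 A2b / §156 A3 observed in words that on
the slice it is a THEOREM («generalized dihedral: an `S₃`-quotient of `A ⋊ C₂` has `A₃`-preimage `A`, so `ℚ(E[2]) ⊂ K[n]` would force `ℚ(√Δ_E) = K`,
impossible for door-admissible `K`; at `n = 0` it reads `E(K)[2] = 0`») and kept it as typed.  This file proves it, for EVERY `n : ℕ` (including the
degenerate conductor `0` and the conductors meeting `2N`), from three tree theorems of other seats:

* route GenusKolyvaginAtTwo's Lemma 4.3 at `2` (gk2-p2 g7, `GenusExact.torsionBy_two_ringClassField_eq_bot`: `ρ̄_{W,2}` onto, `d_K·Δ_W ∉ ℚ²`, `n ≠ 0`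
  ⇒ `E(K[n])[2] = 0`; `K[n]/K` abelian, Cox §9.A);
* `GenusExact.not_isSquare_discr_mul_Δ_of_satisfiesHeegnerHypothesis` (Heegner hypothesis + `d_K ≠ −4` ⇒ `d_K·Δ_W ∉ ℚ²`) and the line's
  `RankOneAtTwoOneDoor.satisfiesHeegnerHypothesis_of_doorAdmissible` (fkl-p2 g7);
* the conductor-`0` case by the inclusion `K[0] = ι(K) ⊆ K[1]` (no reduced form of discriminant `0`) and injectivity of `E(K[0]) → E(K[1])`.

Main statements (namespace `…Theorems.RankOneAtTwoOneDoor`):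
* `ringClassField_zero_le` — `K[0] ≤ K[n]` in `ℂ` for every `n`;
* `forall_ringClassField_two_nsmul_eq_zero_of_not_isSquare` — `ρ̄_{W,2}` onto and `d_K·Δ_W ∉ ℚ²` ⇒ the tower binder, all `n`;
* `forall_ringClassField_two_nsmul_eq_zero_of_doorAdmissible` — the same for a globally minimal `W` with `ρ̄_{W,2}` onto at a DOOR-ADMISSIBLE `d_K`;
* `forall_ringClassField_two_nsmul_eq_zero_slice` — the same under the slice's `∀ n, ρ_{W,2^n}` onto;
* `classVanishesModTwo_of_kolyvaginSystemVanishesModTwoAtGenusDoors`, `firstLayerClassVanishes_of_firstLayerVanishesAtGenusDoors` — ES-25g and ES-24g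
  imply their binder-free forms (the binder is idle on the slice).
-/

set_option autoImplicit false
set_option linter.dupNamespace false

noncomputable section

open scoped Classical

namespace Summit.BirchSwinnertonDyer.BirchSwinnertonDyer.Theorems.RankOneAtTwoOneDoor

open WeierstrassCurve NumberField
open Literature.NumberTheory.EllipticCurves Literature.NumberTheory.EllipticCurves.ModularForms
open Literature.NumberTheory.QuadraticFields.BinaryQuadraticForm
open Summit.BirchSwinnertonDyer.BirchSwinnertonDyer.Theorems.GenusExact
open Summit.BirchSwinnertonDyer.Rank1Residual.F1Sign2.FirstDerivativeAtTwo
open Summit.BirchSwinnertonDyer.Rank1Residual.F1Sign2.KolyvaginSystemAtTwo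

variable {K : Type} [Field K] [NumberField K]

/-! ## §1 The degenerate conductor `0`: `K[0] = ι(K) ⊆ K[n]` -/

/-- **`K[0] ≤ K[n]`**: the tree's ring class "field of conductor `0`" is `ι(K)` (there is no reduced form of discriminant `0·d_K = 0`), which lies in every
`K[n]`. [cite: Cox2013, §9.A] -/
theorem ringClassField_zero_le (ι : K →+* ℂ) (n : ℕ) : ringClassField K ι 0 ≤ ringClassField K ι n := by
  have h0 : ringClassSingularModuli K 0 = ∅ := by
    simp [ringClassSingularModuli, reducedForms, coeffBound]
  unfold ringClassField
  rw [h0]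
  exact Subfield.closure_mono (by simp)

/-! ## §2 No `2`-torsion in the whole tower -/

/-- **No `2`-torsion anywhere in the ring class tower** (Gross 1991 Lemma 4.3 at `p = 2`, all conductors): for `W/ℚ` elliptic with `ρ̄_{W,2}` onto and `K`
imaginary quadratic with `d_K · Δ_W ∉ ℚ²` (`K ≠ ℚ(√Δ_W)`), `E(K[n])[2] = 0` for EVERY `n : ℕ` — `n ≠ 0` is route GenusKolyvaginAtTwo's
`GenusExact.torsionBy_two_ringClassField_eq_bot` (`K[n]/K` abelian), `n = 0` follows through the injection `E(K[0]) ↪ E(K[1])`.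
[cite: GrossLMS1991, §4 Lemma 4.3] [cite: Kolyvagin1989Izv, Thm. B] [cite: Cox2013, §9.A] -/
theorem forall_ringClassField_two_nsmul_eq_zero_of_not_isSquare (W : WeierstrassCurve ℚ) [W.IsElliptic]
    (hρ : W.HasSurjectiveModNGaloisRep 2) (hK : IsImaginaryQuadratic K) (hsq : ¬ IsSquare ((NumberField.discr K : ℚ) * W.Δ))
    (ι : K →+* ℂ) :
    ∀ (n : ℕ) (Q : (W.baseChange (ringClassField K ι n)).toAffine.Point), 2 • Q = 0 → Q = 0 := by
  -- `n ≠ 0`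
  have hpos : ∀ (n : ℕ), n ≠ 0 → ∀ (Q : (W.baseChange (ringClassField K ι n)).toAffine.Point), 2 • Q = 0 → Q = 0 := by
    intro n hn Q hQ
    have hbot := torsionBy_two_ringClassField_eq_bot W hK ι hn hρ hsq
    have hmem : Q ∈ AddSubgroup.torsionBy (W.baseChange (ringClassField K ι n)).toAffine.Point ((2 : ℕ) : ℤ) :=
      (Submodule.mem_torsionBy_iff _ Q).mpr (by exact_mod_cast hQ)
    rw [hbot] at hmem
    exact (AddSubgroup.mem_bot).mp hmem
  intro n
  rcases eq_or_ne n 0 with rfl | hn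
  · -- `n = 0`: push into `K[1]`
    intro Q hQ
    set f : ringClassField K ι 0 →ₐ[ℚ] ringClassField K ι 1 := (Subfield.inclusion (ringClassField_zero_le ι 1)).toRatAlgHom
    have hinj : Function.Injective (WeierstrassCurve.Affine.Point.map (W' := W) f) :=
      WeierstrassCurve.Affine.Point.map_injective _
    apply hinj
    rw [map_zero]
    exact hpos 1 one_ne_zero _ (by rw [← map_nsmul, hQ, map_zero])
  · exact hpos n hn

/-- **The tower binder at a DOOR-ADMISSIBLE field.** For a globally minimal elliptic `W/ℚ` with `ρ̄_{W,2}` onto and `K` imaginary quadratic with `d_K`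
door-admissible (`d_K ≡ 1 (8)`, primes of `d_K` good, odd bad primes split): `d_K ≡ 1 (8)` gives `d_K ≠ −4`, door-admissibility gives the Heegner hypothesis
(`satisfiesHeegnerHypothesis_of_doorAdmissible`), hence `d_K·Δ_W ∉ ℚ²` (`not_isSquare_discr_mul_Δ_of_satisfiesHeegnerHypothesis`), hence no `2`-torsion in
any `K[n]`. [cite: GrossLMS1991, §4 Lemma 4.3] -/
theorem forall_ringClassField_two_nsmul_eq_zero_of_doorAdmissible (W : WeierstrassCurve ℚ) [W.IsElliptic] [W.IsGloballyMinimal]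
    (hρ : W.HasSurjectiveModNGaloisRep 2) (hK : IsImaginaryQuadratic K) (hadm : DoorAdmissible W (NumberField.discr K)) (ι : K →+* ℂ) :
    ∀ (n : ℕ) (Q : (W.baseChange (ringClassField K ι n)).toAffine.Point), 2 • Q = 0 → Q = 0 := by
  have hH : SatisfiesHeegnerHypothesis (W.conductorNorm ℤ) K := satisfiesHeegnerHypothesis_of_doorAdmissible W K hK hadm
  have hD4 : NumberField.discr K ≠ -4 := by
    have h8 := hadm.2.2.1
    omega
  exact forall_ringClassField_two_nsmul_eq_zero_of_not_isSquare W hρ hK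
    (not_isSquare_discr_mul_Δ_of_satisfiesHeegnerHypothesis W hK hH hD4) ι

/-- **The tower binder on the `23715` slice** (big `2`-adic image: `ρ_{W,2^n}` onto for all `n`, so in particular `ρ̄_{W,2}` onto) at a door-admissible
field. -/
theorem forall_ringClassField_two_nsmul_eq_zero_slice (W : WeierstrassCurve ℚ) [W.IsElliptic] [W.IsGloballyMinimal]
    (himg : ∀ n : ℕ, W.HasSurjectiveModNGaloisRep ((2 ^ n : ℕ) : ℤ)) (hK : IsImaginaryQuadratic K)
    (hadm : DoorAdmissible W (NumberField.discr K)) (ι : K →+* ℂ) :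
    ∀ (n : ℕ) (Q : (W.baseChange (ringClassField K ι n)).toAffine.Point), 2 • Q = 0 → Q = 0 :=
  forall_ringClassField_two_nsmul_eq_zero_of_doorAdmissible W (by simpa using himg 1) hK hadm ι

/-! ## §3 Consequence: the binder is idle in ES-25g and ES-24g -/

/-- **ES-25g without its tower binder.** -es g16's CANDIDATE `KolyvaginSystemVanishesModTwoAtGenusDoors` implies the same statement with the hypothesis
«no `2`-torsion in the ring class tower» DELETED (it holds on the slice at every door-admissible field, §2). Nothing is asserted about ES-25g itself. -/
theorem classVanishesModTwo_of_kolyvaginSystemVanishesModTwoAtGenusDoors (h : KolyvaginSystemVanishesModTwoAtGenusDoors) :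
    ∀ (W : WeierstrassCurve ℚ) [W.IsElliptic] [W.IsGloballyMinimal] [NeZero (W.conductorNorm ℤ)],
    ¬ W.HasCM → (∀ k : ℕ, W.HasSurjectiveModNGaloisRep ((2 ^ k : ℕ) : ℤ)) → Odd W.torsionOrder → Odd W.tamagawaProduct →
    W.analyticRank = 1 →
    ∀ (K : Type) [Field K] [NumberField K], IsImaginaryQuadratic K → DoorAdmissible W (discr K) →
    (W.quadraticTwist (discr K : ℚ)).entireLFunction 1 ≠ 0 →
    (if W.Δ < 0 then 1 else 0) + 2 ≤ transpCount W (discr K) + 2 * identCount W (discr K) →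
    ∀ (Dt : ModularParametrizationData W (W.conductorNorm ℤ)) (ι : K →+* ℂ),
      ∀ n : ℕ, IsLevelTwoKolyvaginLevel W K n → ∀ (β : ℤ) (d : KolyvaginHeegnerData Dt β ι n), ClassVanishesModTwo d := by
  intro W _ _ _ hCM himg hT hc hr K _ _ hK hadm hL hex Dt ι n hn β d
  exact h W hCM himg hT hc hr K hK hadm hL hex Dt ι (forall_ringClassField_two_nsmul_eq_zero_slice W himg hK hadm ι) n hn β d

/-- **ES-24g without its tower binder.** -es g15's `FirstLayerVanishesAtGenusDoors` implies the same statement with the hypothesis «no `2`-torsion in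
the ring class tower» DELETED. Nothing is asserted about ES-24g itself. -/
theorem firstLayerClassVanishes_of_firstLayerVanishesAtGenusDoors (h : FirstLayerVanishesAtGenusDoors) :
    ∀ (W : WeierstrassCurve ℚ) [W.IsElliptic] [W.IsGloballyMinimal] [NeZero (W.conductorNorm ℤ)],
    ¬ W.HasCM → (∀ n : ℕ, W.HasSurjectiveModNGaloisRep ((2 ^ n : ℕ) : ℤ)) → Odd W.torsionOrder → Odd W.tamagawaProduct →
    W.analyticRank = 1 →
    ∀ (K : Type) [Field K] [NumberField K], IsImaginaryQuadratic K → DoorAdmissible W (discr K) →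
    (W.quadraticTwist (discr K : ℚ)).entireLFunction 1 ≠ 0 →
    (if W.Δ < 0 then 1 else 0) + 2 ≤ transpCount W (discr K) + 2 * identCount W (discr K) →
    ∀ (Dt : ModularParametrizationData W (W.conductorNorm ℤ)) (H : HeegnerDatum (W.conductorNorm ℤ) (discr K)) (ι : K →+* ℂ)
      (P : (W.baseChange K).toAffine.Point),
      WeierstrassCurve.Affine.Point.map ι.toRatAlgHom P = heegnerPointComplex Dt H → ¬ (2 : ℤ) ∣ Dt.c →
      ∀ m : ℕ, 1 ≤ m → HasTwoDivisibilityUpToTorsion W K P m →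
      ∀ ℓ : ℕ, IsLevelTwoKolyvaginPrime W K ℓ → ∀ (β : ℤ) (d : KolyvaginHeegnerData Dt β ι ℓ), FirstLayerClassVanishes d := by
  intro W _ _ _ hCM himg hT hc hr K _ _ hK hadm hL hex Dt H ι P hP hodd m hm hdiv ℓ hℓ β d
  exact h W hCM himg hT hc hr K hK hadm hL hex Dt H ι P hP hodd (forall_ringClassField_two_nsmul_eq_zero_slice W himg hK hadm ι) m hm hdiv ℓ hℓ β d

end Summit.BirchSwinnertonDyer.BirchSwinnertonDyer.Theorems.RankOneAtTwoOneDoor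

end
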